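import Mathlib.Algebra.Module.Projective
import Mathlib.RingTheory.Finiteness.Cardinality
import Mathlib.LinearAlgebra.TensorProduct.Pi
import Mathlib.LinearAlgebra.TensorProduct.Tower
import Mathlib.RingTheory.TensorProduct.Pi
import Mathlib.Data.Matrix.ColumnRowPartitioned
import Mathlib.LinearAlgebra.Matrix.ToLin
import HarnessLib

/-!
# The kernel of a map of finite projective modules, after any base change, is the kernel of one matrix — functorially (Görtz–Wedhorn II, Cor. 23.137 / proof of Prop. 23.117)

For a linear map `d : P₀ → P₁` between finitely generated projective modules over a commutative
ring `A` there is a matrix `M ∈ M_{n × m}(A)` with `Ker(M ⊗ B) ≅ Ker(d ⊗ B)` for every `A`-algebra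
`B`, functorially in `B` (Görtz–Wedhorn II, Cor. 23.137, p. 480: isomorphisms "functorial in the
`A`-algebra `B`"; the matrix comes from the step "we may assume that `E` is a bounded above complex
of free modules of finite rank" of the proof of Prop. 23.117, p. 466, done without shrinking by
realising `P₀`, `P₁` as direct summands of `A^m`, `A^n` and stacking the matrices of `s₁ d π₀` and
`1 - s₀ π₀`). In this tree the statement exists twice under `Literature/AlgebraicGeometry/Motives`:
`exists_matrix_forall_ker_equiv_ker_baseChange` (`Motives/GrothendieckComplexH0Projective`, as
`Nonempty` per `B`) and `exists_matrix_kerEquiv_baseChange_natural`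
(`Motives/GrothendieckComplexMatrixNatural`, functorial along every `u : B →ₐ[A] B'` — the nearest
prior art). The present file is the import-free home of the result in `Literature/LinearAlgebra`
(pure linear algebra; it imports only Mathlib), needed because those two files cannot be imported
together with the files on the seesaw theorem that consume the result
(`Motives/SemicontinuityGrothendieckComplex` and `Motives/SeesawSemicontinuityKernelRank` declare
clashing names), and it is a strict superset of both: `exists_matrix_ker_equiv_natural` gives the
isomorphisms `e_B` with (1) functoriality along every `u : B →ₐ[A] B'` and (2) an isomorphism
`e_A : Ker(M) ≅ Ker(d)` over `A` itself with `e_B(x ⊗ 1) = 1 ⊗ e_A(x)` — the form in which the base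
change map of (23.28.6) along `A → κ(t)` is consumed. The auxiliary declarations keep the names of
the `Motives` copies they are meant to supersede in a later librarian pass:
`kerInfKerEquivKerOfSplit`, `piScalarRight_baseChange_toLin'`, `mem_ker_baseChange_iff`
(from `GrothendieckComplexH0Projective`), `piScalarRight_rTensor`
(from `GrothendieckComplexMatrixNatural`; the `rTensor_baseChange` of that file is Mathlib's
`LinearMap.rTensor_baseChange` and is used from Mathlib here). Mathlib searched (pin):
`Module.Finite.exists_fin'`, `Module.projective_lifting_property`,
`LinearMap.baseChange_tmul/comp/id/sub`, `LinearMap.rTensor_tmul`, `LinearMap.rTensor_baseChange`,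
`TensorProduct.piScalarRight`, `TensorProduct.piScalarRight_symm_algebraMap`,
`LinearMap.toMatrix'_mulVec`, `Matrix.toLin'_toMatrix'`, `Matrix.fromRows_mulVec`,
`RingHom.map_mulVec`, `LinearEquiv.ofSubmodule'` (all used); no such statement exists in Mathlib.

## References

* U. Görtz, T. Wedhorn, *Algebraic Geometry II: Cohomology of Schemes*, Springer Spektrum (2023),
  doi:10.1007/978-3-658-43031-3: proof of Prop. 23.117, p. 466; Cor. 23.137, p. 480; (23.28.6),
  p. 482 (read via the held copy). [GortzWedhorn2023]
-/

universe u v w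

open TensorProduct
open scoped Matrix

noncomputable section

namespace Literature.LinearAlgebra.Matrix

/-! ### Kernels of maps of direct summands -/

section Retract

variable {B : Type*} [CommRing B] {F₀ P₀ P₁ F₁ : Type*}
  [AddCommGroup F₀] [Module B F₀] [AddCommGroup P₀] [Module B P₀]
  [AddCommGroup P₁] [Module B P₁] [AddCommGroup F₁] [Module B F₁]

/-- **Kernel of a map between direct summands.** If `π₀ : F₀ → P₀` has the section `s₀`
(`π₀ s₀ = 1`), `s₁ : P₁ → F₁` is injective and `d : P₀ → P₁`, then
`Ker(s₁ d π₀) ∩ Ker(1 - s₀ π₀) ≅ Ker d` by `x ↦ π₀ x`, with inverse `p ↦ s₀ p` (same name, statement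
and proof as `Literature.AlgebraicGeometry.Motives.kerInfKerEquivKerOfSplit` of
`Motives/GrothendieckComplexH0Projective`, which this import-free copy is meant to supersede, see
the module docstring). [folklore] -/
def kerInfKerEquivKerOfSplit (π₀ : F₀ →ₗ[B] P₀) (s₀ : P₀ →ₗ[B] F₀) (h₀ : π₀ ∘ₗ s₀ = LinearMap.id)
    (s₁ : P₁ →ₗ[B] F₁) (hs₁ : Function.Injective s₁) (d : P₀ →ₗ[B] P₁) :
    ↥(LinearMap.ker (s₁ ∘ₗ d ∘ₗ π₀) ⊓ LinearMap.ker (LinearMap.id - s₀ ∘ₗ π₀)) ≃ₗ[B]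
      LinearMap.ker d where
  toFun x := ⟨π₀ x, by
    have hx := (Submodule.mem_inf.1 x.2).1
    rw [LinearMap.mem_ker, LinearMap.comp_apply, LinearMap.comp_apply] at hx
    rw [LinearMap.mem_ker]
    exact hs₁ (by rw [hx, map_zero])⟩
  invFun p := ⟨s₀ p, by
    have hp : d p = 0 := p.2
    have h₀' : π₀ (s₀ p) = p := by
      simpa using LinearMap.congr_fun h₀ (p : P₀)
    refine Submodule.mem_inf.2 ⟨?_, ?_⟩
    · rw [LinearMap.mem_ker, LinearMap.comp_apply, LinearMap.comp_apply, h₀', hp, map_zero]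
    · rw [LinearMap.mem_ker, LinearMap.sub_apply, LinearMap.id_apply, LinearMap.comp_apply, h₀',
        sub_self]⟩
  map_add' x y := by
    ext
    simp
  map_smul' c x := by
    ext
    simp
  left_inv x := by
    have hx := (Submodule.mem_inf.1 x.2).2
    rw [LinearMap.mem_ker, LinearMap.sub_apply, LinearMap.id_apply, LinearMap.comp_apply,
      sub_eq_zero] at hx
    ext
    exact hx.symm
  right_inv p := by
    ext
    simpa using LinearMap.congr_fun h₀ (p : P₀)

/-- `kerInfKerEquivKerOfSplit` is `x ↦ π₀ x` on underlying elements. [folklore] -/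
@[simp] theorem coe_kerInfKerEquivKerOfSplit (π₀ : F₀ →ₗ[B] P₀) (s₀ : P₀ →ₗ[B] F₀)
    (h₀ : π₀ ∘ₗ s₀ = LinearMap.id) (s₁ : P₁ →ₗ[B] F₁) (hs₁ : Function.Injective s₁)
    (d : P₀ →ₗ[B] P₁) (x) :
    (kerInfKerEquivKerOfSplit π₀ s₀ h₀ s₁ hs₁ d x : P₀) = π₀ x := rfl

end Retract

/-! ### Base change of a map of finite free modules is the base-changed matrix -/

section BaseChange

variable {A : Type u} [CommRing A] (B : Type v) [CommRing B] [Algebra A B]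

/-- **`G ⊗ B` in coordinates**: under `B ⊗_A A^j ≅ B^j` (Mathlib `TensorProduct.piScalarRight`)
the base change of `G : A^m → A^k` is multiplication by `(toMatrix' G).map (algebraMap A B)`.
[folklore] -/
theorem piScalarRight_baseChange_toLin' {m k : ℕ} (G : (Fin m → A) →ₗ[A] (Fin k → A))
    (z : B ⊗[A] (Fin m → A)) :
    TensorProduct.piScalarRight A B B (Fin k) (G.baseChange B z) =
      ((LinearMap.toMatrix' G).map (algebraMap A B)).mulVecLin
        (TensorProduct.piScalarRight A B B (Fin m) z) := by
  induction z using TensorProduct.induction_on with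
  | zero => simp
  | add x y hx hy => simp only [map_add, hx, hy]
  | tmul b x =>
    rw [LinearMap.baseChange_tmul]
    simp only [TensorProduct.piScalarRight_apply, TensorProduct.piScalarRightHom_tmul,
      Matrix.mulVecLin_apply]
    funext j
    have h1 : G x = LinearMap.toMatrix' G *ᵥ x := (LinearMap.toMatrix'_mulVec G x).symm
    have h2 : algebraMap A B ((LinearMap.toMatrix' G *ᵥ x) j) =
        ((LinearMap.toMatrix' G).map (algebraMap A B) *ᵥ ((algebraMap A B) ∘ x)) j :=
      RingHom.map_mulVec (algebraMap A B) (LinearMap.toMatrix' G) x j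
    have h3 : (fun i => x i • b) = b • ((algebraMap A B) ∘ x) := by
      funext i
      simp [Algebra.smul_def, mul_comm]
    rw [h1, Algebra.smul_def, h2, h3, Matrix.mulVec_smul, Pi.smul_apply, smul_eq_mul, mul_comm]

/-- `z ∈ Ker(G ⊗ B)` iff its coordinate vector lies in the kernel of the base-changed matrix.
[folklore] -/
theorem mem_ker_baseChange_iff {m k : ℕ} (G : (Fin m → A) →ₗ[A] (Fin k → A))
    (z : B ⊗[A] (Fin m → A)) :
    z ∈ LinearMap.ker (G.baseChange B) ↔
      TensorProduct.piScalarRight A B B (Fin m) z ∈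
        LinearMap.ker ((LinearMap.toMatrix' G).map (algebraMap A B)).mulVecLin := by
  rw [LinearMap.mem_ker, LinearMap.mem_ker, ← piScalarRight_baseChange_toLin',
    LinearEquiv.map_eq_zero_iff]

end BaseChange

/-! ### Functoriality of the coordinates in the algebra -/

section Functorial

variable {A : Type u} [CommRing A] {B : Type v} [CommRing B] [Algebra A B]
  {B' : Type w} [CommRing B'] [Algebra A B'] (u : B →ₐ[A] B')

/-- The coordinate isomorphisms `B ⊗_A A^m ≅ B^m` commute with an `A`-algebra homomorphism
`u : B → B'` (acting as `u ⊗ 1` on the left, componentwise on the right); same statement as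
`Literature.AlgebraicGeometry.Motives.piScalarRight_rTensor` (`Motives/GrothendieckComplexMatrixNatural`).
[folklore] -/
theorem piScalarRight_rTensor {m : ℕ} (z : B ⊗[A] (Fin m → A)) :
    TensorProduct.piScalarRight A B' B' (Fin m) (u.toLinearMap.rTensor (Fin m → A) z) =
      fun i => u (TensorProduct.piScalarRight A B B (Fin m) z i) := by
  induction z using TensorProduct.induction_on with
  | zero =>
    simp only [map_zero]
    funext i
    simp
  | add x y hx hy =>
    simp only [map_add, hx, hy]
    funext i
    simp
  | tmul b f =>
    rw [LinearMap.rTensor_tmul]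
    simp only [TensorProduct.piScalarRight_apply, TensorProduct.piScalarRightHom_tmul]
    funext i
    rw [AlgHom.toLinearMap_apply, map_smul]

end Functorial

/-! ### The natural matrix model of `Ker(d ⊗ B)` -/

section Projective

variable {A : Type u} [CommRing A] {P₀ : Type v} {P₁ : Type w}
  [AddCommGroup P₀] [Module A P₀] [AddCommGroup P₁] [Module A P₁]
  [Module.Finite A P₀] [Module.Projective A P₀] [Module.Finite A P₁] [Module.Projective A P₁]

/-- **One matrix computing `Ker(d ⊗ B)` for all `B`, functorially in `B`.** For `d : P₀ → P₁`
linear between finitely generated projective `A`-modules there are a matrix `M ∈ M_{n × m}(A)`, an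
`A`-linear isomorphism `e_A : Ker(M) ≅ Ker(d)` and, for every commutative `A`-algebra `B`, a
`B`-linear isomorphism `e_B : Ker(M ⊗ B) ≅ Ker(d ⊗ B)` — `M ⊗ B` being `M.map (algebraMap A B)`
acting on `B^m` — which are (1) **functorial in the `A`-algebra `B`** (Görtz–Wedhorn II,
Cor. 23.137: isomorphisms "functorial in the `A`-algebra `B`"): for every `A`-algebra homomorphism
`u : B → B'`, `e_{B'}(u ∘ v) = (u ⊗ 1)(e_B(v))` for `v ∈ Ker(M ⊗ B)`; and (2) compatible with
`e_A` along the structure maps: `e_B(x ⊗ 1) = 1 ⊗ e_A(x)` for `x ∈ Ker(M)`. The construction is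
the one of the proof of Prop. 23.117 (p. 466: "we may assume that `E` is a bounded above complex of
free modules of finite rank"), without shrinking: write `P₀`, `P₁` as direct summands of `A^m`,
`A^{n'}` (`π₀ s₀ = 1`, `π₁ s₁ = 1`) and take the stacked matrix of `x ↦ (s₁ d π₀ x, x - s₀ π₀ x)`;
all isomorphisms are `x ↦ π₀ x`. Clause (1) is the statement of
`Literature.AlgebraicGeometry.Motives.exists_matrix_kerEquiv_baseChange_natural`
(`Motives/GrothendieckComplexMatrixNatural`, the nearest prior art in this tree); the delta here is
the import-free home and the isomorphism `e_A` over `A` itself with clause (2), which is the form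
the base change map `Γ(pr⁻¹V, 𝓕) → H⁰(X_t, 𝓕_t)` of (23.28.6) takes (`A → κ(t)`).
[cite: GortzWedhorn2023, Cor. 23.137 (p. 480) with Prop. 23.117, proof (p. 466)] -/
theorem exists_matrix_ker_equiv_natural (d : P₀ →ₗ[A] P₁) :
    ∃ (m n : ℕ) (M : Matrix (Fin n) (Fin m) A) (e₀ : LinearMap.ker M.mulVecLin ≃ₗ[A] LinearMap.ker d)
      (e : ∀ (B : Type u) [CommRing B] [Algebra A B],
        LinearMap.ker (M.map (algebraMap A B)).mulVecLin ≃ₗ[B] LinearMap.ker (d.baseChange B)),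
      (∀ (B : Type u) [CommRing B] [Algebra A B] (B' : Type u) [CommRing B'] [Algebra A B']
        (u : B →ₐ[A] B') (v : LinearMap.ker (M.map (algebraMap A B)).mulVecLin)
        (v' : LinearMap.ker (M.map (algebraMap A B')).mulVecLin),
        (∀ i, (v' : Fin m → B') i = u ((v : Fin m → B) i)) →
          ((e B' v' : LinearMap.ker (d.baseChange B')) : B' ⊗[A] P₀) =
            u.toLinearMap.rTensor P₀ ((e B v : LinearMap.ker (d.baseChange B)) : B ⊗[A] P₀)) ∧
      ∀ (B : Type u) [CommRing B] [Algebra A B] (x : LinearMap.ker M.mulVecLin)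
        (y : LinearMap.ker (M.map (algebraMap A B)).mulVecLin),
        (∀ i, (y : Fin m → B) i = algebraMap A B ((x : Fin m → A) i)) →
          ((e B y : LinearMap.ker (d.baseChange B)) : B ⊗[A] P₀) = 1 ⊗ₜ ((e₀ x : LinearMap.ker d) : P₀) := by
  classical
  obtain ⟨m, π₀, hπ₀⟩ := Module.Finite.exists_fin' A P₀
  obtain ⟨s₀, hs₀⟩ := Module.projective_lifting_property π₀ (LinearMap.id : P₀ →ₗ[A] P₀) hπ₀
  obtain ⟨n, π₁, hπ₁⟩ := Module.Finite.exists_fin' A P₁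
  obtain ⟨s₁, hs₁⟩ := Module.projective_lifting_property π₁ (LinearMap.id : P₁ →ₗ[A] P₁) hπ₁
  -- the two blocks `s₁ d π₀ : A^m → A^n` and `1 - s₀ π₀ : A^m → A^m`, as matrices
  set G₁ : (Fin m → A) →ₗ[A] (Fin n → A) := s₁ ∘ₗ d ∘ₗ π₀ with hG₁
  set G₂ : (Fin m → A) →ₗ[A] (Fin m → A) := LinearMap.id - s₀ ∘ₗ π₀ with hG₂
  set N : Matrix (Fin n) (Fin m) A := LinearMap.toMatrix' G₁ with hN
  set Q : Matrix (Fin m) (Fin m) A := LinearMap.toMatrix' G₂ with hQ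
  set M : Matrix (Fin (n + m)) (Fin m) A := (Matrix.fromRows N Q).submatrix finSumFinEquiv.symm id
    with hM
  -- kernel of the stacked matrix, over any `B`
  have hkerB : ∀ (B : Type u) [CommRing B] [Algebra A B],
      LinearMap.ker (M.map (algebraMap A B)).mulVecLin =
        LinearMap.ker (N.map (algebraMap A B)).mulVecLin ⊓
          LinearMap.ker (Q.map (algebraMap A B)).mulVecLin := by
    intro B _ _
    ext v
    simp only [LinearMap.mem_ker, Submodule.mem_inf, Matrix.mulVecLin_apply, hM,
      ← Matrix.submatrix_map, Matrix.fromRows_map]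
    rw [show ((Matrix.fromRows (N.map (algebraMap A B)) (Q.map (algebraMap A B))).submatrix
        finSumFinEquiv.symm id) = (Matrix.fromRows (N.map (algebraMap A B))
          (Q.map (algebraMap A B))).submatrix finSumFinEquiv.symm (Equiv.refl _) from rfl,
      Matrix.submatrix_mulVec_equiv, Matrix.fromRows_mulVec]
    constructor
    · intro h
      constructor
      · funext i
        have := congr_fun h (finSumFinEquiv (Sum.inl i))
        simpa using this
      · funext i
        have := congr_fun h (finSumFinEquiv (Sum.inr i))
        simpa using this
    · rintro ⟨h1, h2⟩
      funext i
      simp only [Function.comp_apply, Pi.zero_apply]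
      rcases finSumFinEquiv.symm i with i | i
      · simpa using congr_fun h1 i
      · simpa using congr_fun h2 i
  -- over `A` itself: `Ker N ∩ Ker Q = Ker G₁ ∩ Ker G₂ ≅ Ker d`
  have hkerA : LinearMap.ker M.mulVecLin = LinearMap.ker G₁ ⊓ LinearMap.ker G₂ := by
    have h := hkerB A
    simp only [Algebra.algebraMap_self, RingHom.coe_id, Matrix.map_id] at h
    have hN' : N.mulVecLin = G₁ := by rw [← Matrix.toLin'_apply', hN, Matrix.toLin'_toMatrix']
    have hQ' : Q.mulVecLin = G₂ := by rw [← Matrix.toLin'_apply', hQ, Matrix.toLin'_toMatrix']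
    rw [h, hN', hQ']
  have hs₁inj : Function.Injective s₁ := by
    intro p q hpq
    have := congr_arg π₁ hpq
    rwa [← LinearMap.comp_apply, ← LinearMap.comp_apply, hs₁, LinearMap.id_apply,
      LinearMap.id_apply] at this
  let e₀ : LinearMap.ker M.mulVecLin ≃ₗ[A] LinearMap.ker d :=
    (LinearEquiv.ofEq _ _ (hkerA.trans (by rw [hG₁, hG₂]))).trans
      (kerInfKerEquivKerOfSplit π₀ s₀ hs₀ s₁ hs₁inj d)
  have he₀ : ∀ x : LinearMap.ker M.mulVecLin, ((e₀ x : LinearMap.ker d) : P₀) = π₀ x := fun x => rfl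
  -- over a general `B`
  have h₀B : ∀ (B : Type u) [CommRing B] [Algebra A B],
      π₀.baseChange B ∘ₗ s₀.baseChange B = LinearMap.id := fun B _ _ => by
    rw [← LinearMap.baseChange_comp, hs₀, LinearMap.baseChange_id]
  have h₁B : ∀ (B : Type u) [CommRing B] [Algebra A B],
      Function.Injective (s₁.baseChange B) := fun B _ _ => by
    intro p q hpq
    have := congr_arg (π₁.baseChange B) hpq
    rwa [← LinearMap.comp_apply, ← LinearMap.comp_apply, ← LinearMap.baseChange_comp, hs₁,
      LinearMap.baseChange_id, LinearMap.id_apply, LinearMap.id_apply] at this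
  have hGB : ∀ (B : Type u) [CommRing B] [Algebra A B],
      LinearMap.ker (G₁.baseChange B) ⊓ LinearMap.ker (G₂.baseChange B) =
        LinearMap.ker (s₁.baseChange B ∘ₗ d.baseChange B ∘ₗ π₀.baseChange B) ⊓
          LinearMap.ker (LinearMap.id - s₀.baseChange B ∘ₗ π₀.baseChange B) := fun B _ _ => by
    rw [hG₁, hG₂, LinearMap.baseChange_comp, LinearMap.baseChange_comp, LinearMap.baseChange_sub,
      LinearMap.baseChange_id, LinearMap.baseChange_comp]
  have hcomap : ∀ (B : Type u) [CommRing B] [Algebra A B],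
      (LinearMap.ker (N.map (algebraMap A B)).mulVecLin ⊓
        LinearMap.ker (Q.map (algebraMap A B)).mulVecLin).comap
          (TensorProduct.piScalarRight A B B (Fin m) : B ⊗[A] (Fin m → A) →ₗ[B] _) =
        LinearMap.ker (G₁.baseChange B) ⊓ LinearMap.ker (G₂.baseChange B) := fun B _ _ => by
    ext z
    simp only [Submodule.mem_comap, Submodule.mem_inf, LinearEquiv.coe_coe]
    rw [mem_ker_baseChange_iff B G₁ z, mem_ker_baseChange_iff B G₂ z]
  let e : ∀ (B : Type u) [CommRing B] [Algebra A B],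
      LinearMap.ker (M.map (algebraMap A B)).mulVecLin ≃ₗ[B] LinearMap.ker (d.baseChange B) :=
    fun B _ _ =>
      (LinearEquiv.ofEq _ _ (hkerB B)).trans
        ((((TensorProduct.piScalarRight A B B (Fin m)).ofSubmodule' _).symm.trans
          (LinearEquiv.ofEq _ _ ((hcomap B).trans (hGB B)))).trans
          (kerInfKerEquivKerOfSplit (π₀.baseChange B) (s₀.baseChange B) (h₀B B)
            (s₁.baseChange B) (h₁B B) (d.baseChange B)))
  have he : ∀ (B : Type u) [CommRing B] [Algebra A B]
      (y : LinearMap.ker (M.map (algebraMap A B)).mulVecLin),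
      ((e B y : LinearMap.ker (d.baseChange B)) : B ⊗[A] P₀) =
        π₀.baseChange B ((TensorProduct.piScalarRight A B B (Fin m)).symm (y : Fin m → B)) :=
    fun B _ _ y => rfl
  refine ⟨m, n + m, M, e₀, e, fun B _ _ B' _ _ u v v' hvv' => ?_, fun B _ _ x y hxy => ?_⟩
  · -- functoriality in the `A`-algebra `B`
    rw [he, he, LinearMap.rTensor_baseChange]
    congr 1
    apply (TensorProduct.piScalarRight A B' B' (Fin m)).injective
    rw [LinearEquiv.apply_symm_apply, piScalarRight_rTensor u, LinearEquiv.apply_symm_apply]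
    funext i
    exact hvv' i
  · -- compatibility with `e_A` along `A → B`
    rw [he, he₀]
    have hy : (y : Fin m → B) = fun i => algebraMap A B ((x : Fin m → A) i) := funext hxy
    have hsymm : (TensorProduct.piScalarRight A B B (Fin m)).symm
        (fun i => algebraMap A B ((x : Fin m → A) i)) = 1 ⊗ₜ[A] (x : Fin m → A) :=
      TensorProduct.piScalarRight_symm_algebraMap A B (Fin m) (N := B) (x : Fin m → A)
    rw [hy, hsymm, LinearMap.baseChange_tmul]

end Projective

end Literature.LinearAlgebra.Matrix

end
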